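import Mathlib
import Summits.QuantumFields.YangMills.Theorems.BalabanUVNodesN15BackgroundLayerFirstOrder
import Summits.QuantumFields.YangMills.Theorems.BalabanUVNodesN15BackgroundPairSpaceMatrix
import HarnessLib

/-!
# Route «BalabanUVNodes» (cluster K4 «SpineRates»), Track-A DAG node N15 = spine estimate NE2, BACKGROUND LAYER — `T4EtaRate.NE2PlusOperator` BY NAME FOR
# THE NON-ABELIAN FIRST-ORDER SPECIES `V = M_C + Σ_μ M_{A_μ}∘∇_μ` WITH MATRIX COEFFICIENTS: the `𝔤 ≅ ℝ^ι`-valued coefficient carrier with the (3.35)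
# letter pair on every matrix entry, entries 0∕1 of the background-dependent pair CONSTRUCTED over the stacked product carrier, letters read off `Reg335`

Cell `pub-ymgap`, seat `pub-ymgap-dag-n15-c` (generation g0; R134 ACCELERATION SEAT, strategy s1; n15-b HANDOFF §g5.7 (N1) «free for n15-c»; HUMAN RULING
D-0062; chair R424 venue).  `bears_on: R4∕N15`.  Filed `--supports stmt-QuantumFields-19676` (K3; helper).  Imports n15-b's part B2 `…N15.BackgroundLayer`
(`fineGeo`, `abs_blockAvg_le`, `bgConst`, `poly0_le`, `projO`; through it B1a∕B1b∕A1–A3 and g0's `…N15.OperatorReadout`) and this seat's M1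
`…N15BackgroundPairSpaceMatrix` (`unstackM`, `bgPairM`, `hasMaj_idef_bgPairM_proj`; part 14's `liftMap`, `liftBlk`) BY NAME; nothing in the tree is modified.

THE POINT.  Part B2 is the by-name readout of the first-order background layer for SCALAR coefficients; the print's `V′₁(A)` ([Balaban1985BackgroundPropagators]
(3.50)–(3.52) p. 400) has MATRIX coefficients (`ad_{A(b)}`, `exp(iη ad_{A(b)})`, `F′_{1,k}(ad_{A(b)})` on `𝔤`).  THIS FILE is B2 for matrix coefficients over M1's
non-abelian pair `bgPairM`: the carrier `coeffBgM₁` (`U = (C′, (A′_μ)_μ)`, `C′, A′_μ : X′ → Matrix ι ι ℝ`; `Reg335 c α₀ U` = the (3.35) letter pair p. 396 ON EVERY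
MATRIX ENTRY: `|·_{ij}| ≤ c·M·α₀`, `FibreOsc π (·_{ij}) (c·M·α₀·θ)`), transport = entrywise block average, instances over `opGeo g (X × ι) (liftBlk blk ι)`
(`𝔤`-valued test functions), entry operators `bgOpsM₁` (entries 0∕1 = components of `bgPairM`, 2∕3 the consumer's); under the guard `M ≥ 1`, `M·α₀ ≤ a₀`,
`β·(c₃₅·c_ι·a₀)·c_r ≤ ½`, `c_ι = |ι|(1+|J|)`, the row letters are `≤ |ι|·c₃₅Mα₀` and the row fits `≤ |ι|·c₃₅Mα₀·θ` — M1's matrix letters — so `EtaRateIneq342`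
holds per index with `bgConst(β, c_r, m₀, c₃₅c_ι, a₀)` (Thm 3.1 (3.42) p. 397 shape) and `NE2PlusOperator c₃₅` for any family, `M₅ = 1`, `a₀ = (2c₃₅c_ι(βc_r+1))⁻¹`.

CONTENTS ([folklore] bookkeeping; 6 defs).  §1 `coeffBgM₁` (`reg335_coeffBgM₁_iff`), `avgM₁` (`avgM₁_zero`), `bgPairingM₁`, `bgInstanceM₁`, `bgInstanceM₁_M`
(guard = the datum's `M`: LIVE).  §2 `bgOpsM₁`, `bgFamilyM₁`; `rowLetters_of_reg335M`; **`hasMaj_entry01_backgroundM₁`** (entries 0∕1 of the NON-ABELIAN pair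
`≤ bgConst(β, c_r, m₀, c₃₅c_ι, a₀)·θ·e^{−(δ−σ)d}` under the guard).  §3 **`etaRateIneq342_backgroundM₁`** (per index, `B₀ = max bgConst B₃`, `δ₀ = min (δ−σ) ρ₃`);
**`ne2PlusOperator_backgroundM₁`** (any family; `M₅ := 1`, `a₀ := (2c₃₅c_ι(βc_r + 1))⁻¹`; (3.35) CONSUMED on every entry of every matrix coefficient).

HONEST FRAMING ∕ LIMITS.  Bookkeeping + linear algebra over hypothesis-shaped data: the `U ≡ 1` layer on the product carrier DISPLAYED; matrix coefficients as
ABSTRACT configurations (deriving them from a gauge field through `exp(iη ad_A)` with the operator-norm letters `≤ κ_e‖·‖` of parts 13b∕16∕18 is the sequel);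
entries 2∕3 displayed (B3's `bgSourceV`∕`bgDerivedV` apply verbatim over `unstackM` — sequel); linearised entrywise block-average transport; `ι` nonempty; the guard
reads the datum's `M`; nothing about Bałaban's `G(U)` asserted.  NE2⁺ NOT PRINTED, NOT proved; count-neutral (typed 28∕28; nothing discharged); N15 NOT
discharged; one finite lattice at fixed ε — NOT infinite volume, NOT OS on ℝ⁴, NOT a mass gap, NOT Clay.
-/

noncomputable section

open scoped BigOperators

namespace Summit.QuantumFields.YangMills.BalabanUVNodes.N15.BackgroundLayer

open Literature.MathematicalPhysics.QuantumFieldTheory.Balaban1983to89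
open Literature.MathematicalPhysics.QuantumFieldTheory.Balaban1983to89.B11SectG (BlockNorm HasMaj RowSum)
open Literature.MathematicalPhysics.QuantumFieldTheory.Balaban1983to89.T4EtaRate (PairedInstance EtaPairing EtaRateIneq342 NE2PlusOperator rateFactor)
open Literature.MathematicalPhysics.QuantumFieldTheory.Balaban1983to89.T4EtaRateDefect (idef rateWeight)
open Literature.MathematicalPhysics.QuantumFieldTheory.Balaban1983to89.T4EtaRateCoeffDefect (pull pull_apply FibreOsc blockAvg fit_blockAvg)
open Literature.MathematicalPhysics.QuantumFieldTheory.Balaban1983to89.B6RandomWalk (Triangle254)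
open Literature.MathematicalPhysics.QuantumFieldTheory.Balaban1983to89.B9SectDSup (inv_one_sub_le_two)
open Summit.QuantumFields.YangMills.BalabanUVNodes.N15.OperatorReadout (opGeo opFamily opGeo_len rateFactor_opGeo etaRateIneq342_of_hasMaj)
open Summit.QuantumFields.YangMills.BalabanUVNodes.N15.MatrixSpecies (liftMap liftBlk)

/-! ## §1 The matrix-coefficient carrier, the pairing, the instances -/

section Carrier

variable {X X' : Type} (J ι : Type) [Fintype ι]

/-- THE NON-ABELIAN FIRST-ORDER COEFFICIENT CARRIER: configurations are FAMILIES `U = (C′, (A′_μ)_μ)` of fine MATRIX-valued coefficient fields (the species of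
(3.52): `V′ = M_{C′} + Σ_μ M_{A′_μ}∘∇′_μ` on `𝔤 ≅ ℝ^ι`-valued fields), `one := 0`, `mul := (+)`, and `Reg335 c α₀ U` = THE (3.35) LETTER PAIR ON EVERY ENTRY OF
EVERY COEFFICIENT: sup letters `|C′(x′)_{ij}|, |A′_μ(x′)_{ij}| ≤ c·M·α₀` and within-block oscillation letters `FibreOsc π (C′(·)_{ij}) (c·M·α₀·θ)`; `Reg336` repeats
it; (3.37)–(3.38) inert. [cite: Balaban1985BackgroundPropagators, (3.35) p.396 (shape); (3.50)–(3.52) p.400 (first-order perturbation with `ad`-valued coefficients: shape)] -/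
def coeffBgM₁ (π : X' → X) (M θ : ℝ) : B9.Backgrounds where
  Cfg := (X' → Matrix ι ι ℝ) × (J → X' → Matrix ι ι ℝ)
  one := 0
  mul := fun U₁ U₂ => U₁ + U₂
  Reg335 := fun c α₀ U => ((∀ x' i j, |U.1 x' i j| ≤ c * M * α₀) ∧ ∀ μ x' i j, |U.2 μ x' i j| ≤ c * M * α₀) ∧
    ((∀ i j, FibreOsc π (fun x' => U.1 x' i j) (fun _ => c * M * α₀ * θ)) ∧ ∀ μ i j, FibreOsc π (fun x' => U.2 μ x' i j) (fun _ => c * M * α₀ * θ))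
  Reg336 := fun c α₀ U => ((∀ x' i j, |U.1 x' i j| ≤ c * M * α₀) ∧ ∀ μ x' i j, |U.2 μ x' i j| ≤ c * M * α₀) ∧
    ((∀ i j, FibreOsc π (fun x' => U.1 x' i j) (fun _ => c * M * α₀ * θ)) ∧ ∀ μ i j, FibreOsc π (fun x' => U.2 μ x' i j) (fun _ => c * M * α₀ * θ))
  Cplx337 := fun _ _ _ => True
  Cplx338 := fun _ _ _ => True

omit [Fintype ι] in
/-- Unfolding of the carrier's (3.35). [folklore] -/
theorem reg335_coeffBgM₁_iff (π : X' → X) (M θ c α₀ : ℝ) (U : (X' → Matrix ι ι ℝ) × (J → X' → Matrix ι ι ℝ)) :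
    (coeffBgM₁ J ι π M θ).Reg335 c α₀ U ↔ ((∀ x' i j, |U.1 x' i j| ≤ c * M * α₀) ∧ ∀ μ x' i j, |U.2 μ x' i j| ≤ c * M * α₀) ∧
      ((∀ i j, FibreOsc π (fun x' => U.1 x' i j) (fun _ => c * M * α₀ * θ)) ∧
        ∀ μ i j, FibreOsc π (fun x' => U.2 μ x' i j) (fun _ => c * M * α₀ * θ)) := Iff.rfl

variable [Fintype X'] [DecidableEq X]

/-- THE TRANSPORT of a matrix coefficient family: the ENTRYWISE block average of every coefficient (linearised (C3)). [folklore] -/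
def avgM₁ (π : X' → X) (U : (X' → Matrix ι ι ℝ) × (J → X' → Matrix ι ι ℝ)) : (X → Matrix ι ι ℝ) × (J → X → Matrix ι ι ℝ) :=
  (fun x => Matrix.of fun i j => blockAvg π (fun x' => U.1 x' i j) x, fun μ x => Matrix.of fun i j => blockAvg π (fun x' => U.2 μ x' i j) x)

omit [Fintype ι] in
/-- `avg_one`: the transport of the trivial family is trivial. [folklore] -/
theorem avgM₁_zero (π : X' → X) : avgM₁ J ι π (0 : (X' → Matrix ι ι ℝ) × (J → X' → Matrix ι ι ℝ)) = 0 := by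
  have h : ∀ x, blockAvg π (fun _ : X' => (0 : ℝ)) x = 0 := fun x => congrFun (blockAvg_zero π) x
  refine Prod.ext (funext fun x => ?_) (funext fun μ => funext fun x => ?_)
  · ext i j
    simp [avgM₁, h]
  · ext i j
    simp [avgM₁, h]

variable {g : B6.Geometry} [Fintype X]

/-- THE η-PAIRING over the matrix coefficient carriers (NOT PRINTED data): scale shift `n`, identity on sites, pull-back of `𝔤`-valued test functions along
`liftMap π ι`, entrywise block-averaged coefficient families. [cite: King1986, p.664 (convention before Prop. 3.8)] -/
def bgPairingM₁ (blk : X → g.Site) (π : X' → X) (n : ℕ) (hL : g.L ≠ 0) (θc θ : ℝ) :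
    EtaPairing (opGeo g (X × ι) (liftBlk blk ι)) (fineGeo g (X' × ι) (liftBlk (blk ∘ π) ι) n) (coeffBgM₁ J ι (fun x : X => x) g.M θc)
      (coeffBgM₁ J ι π g.M θ) where
  n := n
  k_eq := rfl
  L_eq := rfl
  M_eq := rfl
  eta_eq := by
    show g.eta * (g.L ^ n)⁻¹ * g.L ^ n = g.eta
    rw [mul_assoc, inv_mul_cancel₀ (pow_ne_zero _ hL), mul_one]
  ι := fun y => y
  scale_ι := fun _ => rfl
  dist_ι := fun _ _ => rfl
  τ := fun lam => pull (liftMap π ι) lam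
  suppIn_τ := fun _ _ h p hp => h (liftMap π ι p) hp
  supNorm_τ := fun lam => by
    show (⨆ p : X' × ι, |lam (liftMap π ι p)|) ≤ ⨆ p : X × ι, |lam p|
    exact Real.iSup_le (fun p => abs_le_iSup_abs lam (liftMap π ι p)) (Real.iSup_nonneg fun p => abs_nonneg _)
  avg := avgM₁ J ι π
  avg_one := avgM₁_zero J ι π

/-- THE REALISED PAIRED INSTANCE of the non-abelian first-order background layer (test functions = `𝔤`-valued fields on the lattice, blocked through `liftBlk`).
[cite: Balaban1985BackgroundPropagators, Thm 3.14 pp.426–427 (typing template)] -/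
def bgInstanceM₁ (blk : X → g.Site) (π : X' → X) (n : ℕ) (hL : g.L ≠ 0) (θc θ : ℝ) : PairedInstance :=
  ⟨opGeo g (X × ι) (liftBlk blk ι), fineGeo g (X' × ι) (liftBlk (blk ∘ π) ι) n, coeffBgM₁ J ι (fun x : X => x) g.M θc, coeffBgM₁ J ι π g.M θ,
    bgPairingM₁ J ι blk π n hL θc θ⟩

/-- THE GUARD IS LIVE: the fine geometry's [B9] size parameter is the datum's `M`. [folklore] -/
theorem bgInstanceM₁_M (blk : X → g.Site) (π : X' → X) (n : ℕ) (hL : g.L ≠ 0) (θc θ : ℝ) : (bgInstanceM₁ J ι blk π n hL θc θ).gf.M = g.M := rfl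

end Carrier

/-! ## §2 The entry operators (0∕1 constructed over the non-abelian pair) and their majorants under the guard -/

section Entries

variable {X X' J ι : Type} [Fintype X] [Fintype X'] [Fintype J] [Fintype ι] [DecidableEq X] [DecidableEq X'] [DecidableEq J] [DecidableEq ι]
  {g : B6.Geometry} (blk : X → g.Site) (π : X' → X)

/-- THE FOUR ENTRY OPERATORS at a matrix coefficient family `U`: ENTRY 0 = `𝔇(X′(U), X(Ū))` and ENTRY 1 = `𝔇(∇′_νX′(U), ∇_νX(Ū))`, the `none` ∕ `some ν` components
of the η-difference of M1's non-abelian pair `bgPairM` (`Ū` = the entrywise block-averaged family); ENTRIES 2∕3 the consumer's.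
[cite: Balaban1985BackgroundPropagators, (3.42) p.397 (the four entries: shape)] -/
def bgOpsM₁ (ν : J) (G : (X × ι → ℝ) →ₗ[ℝ] (X × ι → ℝ)) (D : J → (X × ι → ℝ) →ₗ[ℝ] (X × ι → ℝ)) (G' : (X' × ι → ℝ) →ₗ[ℝ] (X' × ι → ℝ))
    (D' : J → (X' × ι → ℝ) →ₗ[ℝ] (X' × ι → ℝ))
    (T : Fin 2 → (X' → Matrix ι ι ℝ) × (J → X' → Matrix ι ι ℝ) → ((X × ι → ℝ) →ₗ[ℝ] (X' × ι → ℝ))) :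
    Fin 4 → (X' → Matrix ι ι ℝ) × (J → X' → Matrix ι ι ℝ) → ((X × ι → ℝ) →ₗ[ℝ] (X' × ι → ℝ)) :=
  fun n U => ![idef (pull (liftMap π ι)) (pull (liftMap π ι)) (projO none ∘ₗ bgPairM G' D' U.1 U.2)
      (projO none ∘ₗ bgPairM G D (avgM₁ J ι π U).1 (avgM₁ J ι π U).2),
    idef (pull (liftMap π ι)) (pull (liftMap π ι)) (projO (some ν) ∘ₗ bgPairM G' D' U.1 U.2)
      (projO (some ν) ∘ₗ bgPairM G D (avgM₁ J ι π U).1 (avgM₁ J ι π U).2),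
    T 0 U, T 1 U] n

/-- THE KERNEL FAMILY over the matrix coefficient carrier (g0 `opFamily` on the product carrier). [cite: Balaban1985BackgroundPropagators, (3.42) p.397 (the four sup entries: shape)] -/
def bgFamilyM₁ (n : ℕ) (hL : g.L ≠ 0) (θc θ : ℝ) (ν : J) (G : (X × ι → ℝ) →ₗ[ℝ] (X × ι → ℝ)) (D : J → (X × ι → ℝ) →ₗ[ℝ] (X × ι → ℝ))
    (G' : (X' × ι → ℝ) →ₗ[ℝ] (X' × ι → ℝ)) (D' : J → (X' × ι → ℝ) →ₗ[ℝ] (X' × ι → ℝ))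
    (T : Fin 2 → (X' → Matrix ι ι ℝ) × (J → X' → Matrix ι ι ℝ) → ((X × ι → ℝ) →ₗ[ℝ] (X' × ι → ℝ))) :
    B9.KernelFamily (bgInstanceM₁ J ι blk π n hL θc θ).gc (bgInstanceM₁ J ι blk π n hL θc θ).Bf :=
  show B9.KernelFamily (opGeo g (X × ι) (liftBlk blk ι)) (coeffBgM₁ J ι π g.M θ) from
    opFamily (g := g) (B := coeffBgM₁ J ι π g.M θ) (liftBlk blk ι) (liftBlk (blk ∘ π) ι) (bgOpsM₁ π ν G D G' D' T)

omit [Fintype X] [Fintype J] [DecidableEq X'] [DecidableEq J] [DecidableEq ι] in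
/-- **THE ROW LETTERS FROM THE ENTRY LETTERS.**  A `Reg335 c₃₅ α₀`-regular matrix coefficient family has, with `r = c₃₅·M·α₀` (`r ≥ 0`): row sums `≤ |ι|·r` at both
spacings (the entrywise block average keeps the sup letter) and row fits `Σ_j |U′_{ij} − Ū_{ij}∘π| ≤ |ι|·r·θ` (`fit_blockAvg` entry by entry).
[cite: Balaban1985BackgroundPropagators, (3.35) p.396 (shape)] -/
theorem rowLetters_of_reg335M {M θ c35 α₀ : ℝ} (hr : 0 ≤ c35 * M * α₀) {U : (X' → Matrix ι ι ℝ) × (J → X' → Matrix ι ι ℝ)}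
    (hreg : (coeffBgM₁ J ι π M θ).Reg335 c35 α₀ U) :
    (∀ x i, ∑ j, |(avgM₁ J ι π U).1 x i j| ≤ c35 * M * α₀ * Fintype.card ι) ∧
      (∀ μ x i, ∑ j, |(avgM₁ J ι π U).2 μ x i j| ≤ c35 * M * α₀ * Fintype.card ι) ∧
      (∀ x' i, ∑ j, |U.1 x' i j| ≤ c35 * M * α₀ * Fintype.card ι) ∧ (∀ μ x' i, ∑ j, |U.2 μ x' i j| ≤ c35 * M * α₀ * Fintype.card ι) ∧
      (∀ x' i, ∑ j, |U.1 x' i j - (avgM₁ J ι π U).1 (π x') i j| ≤ c35 * M * α₀ * Fintype.card ι * θ) ∧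
      (∀ μ x' i, ∑ j, |U.2 μ x' i j - (avgM₁ J ι π U).2 μ (π x') i j| ≤ c35 * M * α₀ * Fintype.card ι * θ) := by
  obtain ⟨⟨hsc, hsa⟩, hoc, hoa⟩ := (reg335_coeffBgM₁_iff J ι π M θ c35 α₀ U).1 hreg
  set r : ℝ := c35 * M * α₀ with hr_def
  have hrow : ∀ {f : ι → ℝ} {b : ℝ}, (∀ j, |f j| ≤ b) → ∑ j, |f j| ≤ b * Fintype.card ι := fun {f b} hf =>
    calc ∑ j, |f j| ≤ ∑ _j : ι, b := Finset.sum_le_sum fun j _ => hf j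
      _ = b * Fintype.card ι := by rw [Finset.sum_const, Finset.card_univ, nsmul_eq_mul, mul_comm]
  have hθ : r * Fintype.card ι * θ = r * θ * Fintype.card ι := by ring
  refine ⟨fun x i => hrow fun j => ?_, fun μ x i => hrow fun j => ?_, fun x' i => hrow fun j => hsc x' i j,
    fun μ x' i => hrow fun j => hsa μ x' i j, fun x' i => ?_, fun μ x' i => ?_⟩
  · show |blockAvg π (fun x' => U.1 x' i j) x| ≤ r
    exact abs_blockAvg_le π hr (fun x' => hsc x' i j) x
  · show |blockAvg π (fun x' => U.2 μ x' i j) x| ≤ r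
    exact abs_blockAvg_le π hr (fun x' => hsa μ x' i j) x
  · rw [hθ]
    exact hrow fun j => by
      show |U.1 x' i j - blockAvg π (fun x'' => U.1 x'' i j) (π x')| ≤ r * θ
      exact fit_blockAvg π (hoc i j) x'
  · rw [hθ]
    exact hrow fun j => by
      show |U.2 μ x' i j - blockAvg π (fun x'' => U.2 μ x'' i j) (π x')| ≤ r * θ
      exact fit_blockAvg π (hoa μ i j) x'

variable {G : (X × ι → ℝ) →ₗ[ℝ] (X × ι → ℝ)} {D : J → (X × ι → ℝ) →ₗ[ℝ] (X × ι → ℝ)} {G' : (X' × ι → ℝ) →ₗ[ℝ] (X' × ι → ℝ)}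
  {D' : J → (X' × ι → ℝ) →ₗ[ℝ] (X' × ι → ℝ)}

/-- **ENTRIES 0∕1 OF THE NON-ABELIAN PAIR UNDER THE GUARD, LETTERS READ OFF `Reg335`.**  `U ≡ 1` layer on the product carrier: pieces and derived pieces `≤ β·e^{−δd}` at
both spacings, defects `𝔇(G′,G), 𝔇(D′_μ,D_μ) ≤ m₀·θ·e^{−δd}`, `σ ≤ δ`; guard: `c₃₅ > 0`, `ι` nonempty, `a₀ ≥ 0`, `β·(c₃₅·(|ι|(1+|J|))·a₀)·c_r ≤ ½`, `M ≥ 1`, `α₀ > 0`,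
`M·α₀ ≤ a₀`; configuration `U` with `(coeffBgM₁ J ι π M θ).Reg335 c₃₅ α₀ U`.  Then for `j ∈ Option J`:
`𝔇(X̂′_j(U), X̂_j(Ū)) ≤ bgConst(β, c_r, m₀, c₃₅·|ι|(1+|J|), a₀)·θ·e^{−(δ−σ)d}`. [cite: Balaban1985BackgroundPropagators, Thm 3.1 p.397 (quantifier template); (3.50)–(3.52) p.400, (3.63)–(3.65) pp.402–403 (shapes, mechanism)] -/
theorem hasMaj_entry01_backgroundM₁ [Nonempty ι] (htri : Triangle254 g) (hd : ∀ a b : g.Site, 0 ≤ g.dist a b) {σ cr : ℝ} (hσ : 0 ≤ σ) (hcr : 0 ≤ cr)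
    (hrow : RowSum g σ cr) {δ β m₀ θ c35 a₀ M α₀ : ℝ} (hσδ : σ ≤ δ) (hβ : 0 ≤ β) (hm₀ : 0 ≤ m₀) (hθ : 0 ≤ θ) (hc35 : 0 < c35)
    (hq : β * (c35 * (Fintype.card ι * (1 + Fintype.card J)) * a₀) * cr ≤ 1 / 2) (hM : 1 ≤ M) (hα₀ : 0 < α₀) (hMα : M * α₀ ≤ a₀)
    (hG : HasMaj (BlockNorm.ofBlocks g (liftBlk blk ι)) (BlockNorm.ofBlocks g (liftBlk blk ι)) G (fun y y' => β * Real.exp (-(δ * g.dist y y'))))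
    (hD : ∀ μ, HasMaj (BlockNorm.ofBlocks g (liftBlk blk ι)) (BlockNorm.ofBlocks g (liftBlk blk ι)) (D μ)
      (fun y y' => β * Real.exp (-(δ * g.dist y y'))))
    (hG' : HasMaj (BlockNorm.ofBlocks g (liftBlk (blk ∘ π) ι)) (BlockNorm.ofBlocks g (liftBlk (blk ∘ π) ι)) G'
      (fun y y' => β * Real.exp (-(δ * g.dist y y'))))
    (hD' : ∀ μ, HasMaj (BlockNorm.ofBlocks g (liftBlk (blk ∘ π) ι)) (BlockNorm.ofBlocks g (liftBlk (blk ∘ π) ι)) (D' μ)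
      (fun y y' => β * Real.exp (-(δ * g.dist y y'))))
    (hDG : HasMaj (BlockNorm.ofBlocks g (liftBlk blk ι)) (BlockNorm.ofBlocks g (liftBlk (blk ∘ π) ι))
      (idef (pull (liftMap π ι)) (pull (liftMap π ι)) G' G) (fun y y' => m₀ * θ * Real.exp (-(δ * g.dist y y'))))
    (hDD : ∀ μ, HasMaj (BlockNorm.ofBlocks g (liftBlk blk ι)) (BlockNorm.ofBlocks g (liftBlk (blk ∘ π) ι))
      (idef (pull (liftMap π ι)) (pull (liftMap π ι)) (D' μ) (D μ)) (fun y y' => m₀ * θ * Real.exp (-(δ * g.dist y y'))))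
    {U : (X' → Matrix ι ι ℝ) × (J → X' → Matrix ι ι ℝ)} (hreg : (coeffBgM₁ J ι π M θ).Reg335 c35 α₀ U) (j : Option J) :
    HasMaj (BlockNorm.ofBlocks g (liftBlk blk ι)) (BlockNorm.ofBlocks g (liftBlk (blk ∘ π) ι))
      (idef (pull (liftMap π ι)) (pull (liftMap π ι)) (projO j ∘ₗ bgPairM G' D' U.1 U.2)
        (projO j ∘ₗ bgPairM G D (avgM₁ J ι π U).1 (avgM₁ J ι π U).2))
      (fun y y' => bgConst β cr m₀ (c35 * (Fintype.card ι * (1 + Fintype.card J))) a₀ * θ * Real.exp (-((δ - σ) * g.dist y y'))) := by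
  set r : ℝ := c35 * M * α₀ with hr_def
  have hι1 : (1 : ℝ) ≤ Fintype.card ι := by exact_mod_cast Fintype.card_pos
  have hι0 : (0 : ℝ) ≤ Fintype.card ι := zero_le_one.trans hι1
  have hJ : (1 : ℝ) ≤ 1 + Fintype.card J := le_add_of_nonneg_right (Nat.cast_nonneg _)
  have hJ0 : (0 : ℝ) ≤ 1 + Fintype.card J := zero_le_one.trans hJ
  have hM0 : 0 ≤ M := zero_le_one.trans hM
  have hr0 : 0 ≤ r := by positivity
  have hra : r ≤ c35 * a₀ := by rw [hr_def, mul_assoc]; exact mul_le_mul_of_nonneg_left hMα hc35.le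
  obtain ⟨hc, ha, hc', ha', hfc, hfa⟩ := rowLetters_of_reg335M (J := J) (ι := ι) π hr0 hreg
  set r' : ℝ := r * Fintype.card ι with hr'_def
  have hr'0 : 0 ≤ r' := mul_nonneg hr0 hι0
  have hRa : r' * (1 + Fintype.card J) ≤ c35 * (Fintype.card ι * (1 + Fintype.card J)) * a₀ := by
    calc r' * (1 + Fintype.card J) = r * (Fintype.card ι * (1 + Fintype.card J)) := by rw [hr'_def]; ring
      _ ≤ c35 * a₀ * (Fintype.card ι * (1 + Fintype.card J)) := mul_le_mul_of_nonneg_right hra (mul_nonneg hι0 hJ0)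
      _ = c35 * (Fintype.card ι * (1 + Fintype.card J)) * a₀ := by ring
  have hR0 : 0 ≤ r' * (1 + Fintype.card J) := mul_nonneg hr'0 hJ0
  have hq' : β * (r' * (1 + Fintype.card J)) * cr ≤ 1 / 2 :=
    (mul_le_mul_of_nonneg_right (mul_le_mul_of_nonneg_left hRa hβ) hcr).trans hq
  have hq1 : β * (r' * (1 + Fintype.card J)) * cr < 1 := by linarith
  have hinv : (1 - β * (r' * (1 + Fintype.card J)) * cr)⁻¹ ≤ 2 := inv_one_sub_le_two hq'
  have hinv0 : 0 ≤ (1 - β * (r' * (1 + Fintype.card J)) * cr)⁻¹ := inv_nonneg.2 (by linarith)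
  have hfc' : ∀ x' i, ∑ j, |U.1 x' i j - (avgM₁ J ι π U).1 (π x') i j| ≤ r' * θ := fun x' i => by
    rw [hr'_def]; exact hfc x' i
  have hfa' : ∀ μ x' i, ∑ j, |U.2 μ x' i j - (avgM₁ J ι π U).2 μ (π x') i j| ≤ r' * θ := fun μ x' i => by
    rw [hr'_def]; exact hfa μ x' i
  have key := hasMaj_idef_bgPairM_proj blk π htri hd hσ hcr hrow (ρ := δ - σ) (by linarith) (by linarith) hβ hr'0 (mul_nonneg hr'0 hθ)
    (mul_nonneg hm₀ hθ) hG hD hG' hD' hDG hDD hc ha hc' ha' hfc' hfa' hq1 j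
  refine key.mono fun a b => ?_
  simp only [one_mul]
  refine mul_le_mul_of_nonneg_right ?_ (Real.exp_nonneg _)
  have hpoly := poly0_le (β := β) (cr := cr) (m₀ := m₀) (θ := θ) (c35 := c35 * (Fintype.card ι * (1 + Fintype.card J))) (a₀ := a₀)
    (r := r' * (1 + Fintype.card J)) (u := (1 - β * (r' * (1 + Fintype.card J)) * cr)⁻¹) hβ hcr hm₀ hθ hR0 hRa hinv0 hinv
  have heq : r' * θ * (1 + Fintype.card J) = r' * (1 + Fintype.card J) * θ := by ring
  rw [heq]
  exact hpoly

end Entries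

/-! ## §3 Per index `EtaRateIneq342`, and the node's first conjunct BY NAME for the non-abelian first-order species -/

section PerIndex

variable {X X' J ι : Type} [Fintype X] [Fintype X'] [Fintype J] [Fintype ι] [DecidableEq X] [DecidableEq X'] [DecidableEq J] [DecidableEq ι]
  [Nonempty ι] {g : B6.Geometry} (blk : X → g.Site) (π : X' → X)

/-- **`EtaRateIneq342` PER INDEX, NON-ABELIAN FIRST-ORDER SPECIES, EXPLICIT CONSTANTS.**  Data of `hasMaj_entry01_backgroundM₁` with `η, L > 0`, sites of physical
size `≥ 1`, rate number `θ ≤ (L^j)^{−γ}`, entries 2∕3 operators with majorants `B₃·θ·e^{−ρ₃d}` (`B₃ ≥ 0`): for every `Reg335`-regular matrix family `U` under the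
guard, `EtaRateIneq342 (opFamily (liftBlk blk ι) (liftBlk (blk∘π) ι) (bgOpsM₁ …)) (max bgConst(…) B₃) (min (δ−σ) ρ₃) γ U`. [cite: Balaban1985BackgroundPropagators, Thm 3.1 (3.42) p.397 (shape)] -/
theorem etaRateIneq342_backgroundM₁ (htri : Triangle254 g) (hd : ∀ a b : g.Site, 0 ≤ g.dist a b) {σ cr : ℝ} (hσ : 0 ≤ σ) (hcr : 0 ≤ cr)
    (hrow : RowSum g σ cr) (hη : 0 < g.eta) (hL : 0 < g.L) (hlen : ∀ y, 1 ≤ g.len y) {δ β m₀ θ c35 a₀ M α₀ γ B₃ ρ₃ : ℝ}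
    (hσδ : σ ≤ δ) (hβ : 0 ≤ β) (hm₀ : 0 ≤ m₀) (hθ : 0 ≤ θ) (hθγ : ∀ y, θ ≤ rateWeight g γ y) (hc35 : 0 < c35) (ha₀ : 0 ≤ a₀)
    (hq : β * (c35 * (Fintype.card ι * (1 + Fintype.card J)) * a₀) * cr ≤ 1 / 2) (hM : 1 ≤ M) (hα₀ : 0 < α₀) (hMα : M * α₀ ≤ a₀) (hB₃ : 0 ≤ B₃)
    {ν : J} {G : (X × ι → ℝ) →ₗ[ℝ] (X × ι → ℝ)} {D : J → (X × ι → ℝ) →ₗ[ℝ] (X × ι → ℝ)} {G' : (X' × ι → ℝ) →ₗ[ℝ] (X' × ι → ℝ)}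
    {D' : J → (X' × ι → ℝ) →ₗ[ℝ] (X' × ι → ℝ)}
    {T : Fin 2 → (X' → Matrix ι ι ℝ) × (J → X' → Matrix ι ι ℝ) → ((X × ι → ℝ) →ₗ[ℝ] (X' × ι → ℝ))}
    (hG : HasMaj (BlockNorm.ofBlocks g (liftBlk blk ι)) (BlockNorm.ofBlocks g (liftBlk blk ι)) G (fun y y' => β * Real.exp (-(δ * g.dist y y'))))
    (hD : ∀ μ, HasMaj (BlockNorm.ofBlocks g (liftBlk blk ι)) (BlockNorm.ofBlocks g (liftBlk blk ι)) (D μ)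
      (fun y y' => β * Real.exp (-(δ * g.dist y y'))))
    (hG' : HasMaj (BlockNorm.ofBlocks g (liftBlk (blk ∘ π) ι)) (BlockNorm.ofBlocks g (liftBlk (blk ∘ π) ι)) G'
      (fun y y' => β * Real.exp (-(δ * g.dist y y'))))
    (hD' : ∀ μ, HasMaj (BlockNorm.ofBlocks g (liftBlk (blk ∘ π) ι)) (BlockNorm.ofBlocks g (liftBlk (blk ∘ π) ι)) (D' μ)
      (fun y y' => β * Real.exp (-(δ * g.dist y y'))))
    (hDG : HasMaj (BlockNorm.ofBlocks g (liftBlk blk ι)) (BlockNorm.ofBlocks g (liftBlk (blk ∘ π) ι))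
      (idef (pull (liftMap π ι)) (pull (liftMap π ι)) G' G) (fun y y' => m₀ * θ * Real.exp (-(δ * g.dist y y'))))
    (hDD : ∀ μ, HasMaj (BlockNorm.ofBlocks g (liftBlk blk ι)) (BlockNorm.ofBlocks g (liftBlk (blk ∘ π) ι))
      (idef (pull (liftMap π ι)) (pull (liftMap π ι)) (D' μ) (D μ)) (fun y y' => m₀ * θ * Real.exp (-(δ * g.dist y y'))))
    {U : (X' → Matrix ι ι ℝ) × (J → X' → Matrix ι ι ℝ)} (hreg : (coeffBgM₁ J ι π M θ).Reg335 c35 α₀ U)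
    (hT : ∀ n : Fin 2, HasMaj (BlockNorm.ofBlocks g (liftBlk blk ι)) (BlockNorm.ofBlocks g (liftBlk (blk ∘ π) ι)) (T n U)
      (fun y y' => B₃ * θ * Real.exp (-(ρ₃ * g.dist y y')))) :
    EtaRateIneq342 (opFamily (g := g) (B := coeffBgM₁ J ι π M θ) (liftBlk blk ι) (liftBlk (blk ∘ π) ι) (bgOpsM₁ π ν G D G' D' T))
      (max (bgConst β cr m₀ (c35 * (Fintype.card ι * (1 + Fintype.card J))) a₀) B₃) (min (δ - σ) ρ₃) γ U := by
  have hcι : (0 : ℝ) ≤ c35 * (Fintype.card ι * (1 + Fintype.card J)) := by positivity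
  have h01 := hasMaj_entry01_backgroundM₁ blk π htri hd hσ hcr hrow hσδ hβ hm₀ hθ hc35 hq hM hα₀ hMα hG hD hG' hD' hDG hDD hreg
  have hC0 : 0 ≤ bgConst β cr m₀ (c35 * (Fintype.card ι * (1 + Fintype.card J))) a₀ := bgConst_nonneg hβ hcr hm₀ hcι ha₀
  have hB₀ : 0 ≤ max (bgConst β cr m₀ (c35 * (Fintype.card ι * (1 + Fintype.card J))) a₀) B₃ := hC0.trans (le_max_left _ _)
  refine etaRateIneq342_of_hasMaj (g := g) (B := coeffBgM₁ J ι π M θ) (liftBlk blk ι) (liftBlk (blk ∘ π) ι) hη.le hL.le hB₀ (bgOpsM₁ π ν G D G' D' T) U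
    fun n => ?_
  have hdom : ∀ {B ρ : ℝ}, 0 ≤ B → B ≤ max (bgConst β cr m₀ (c35 * (Fintype.card ι * (1 + Fintype.card J))) a₀) B₃ → min (δ - σ) ρ₃ ≤ ρ →
      ∀ y y' : g.Site, B * θ * Real.exp (-(ρ * g.dist y y')) ≤
        max (bgConst β cr m₀ (c35 * (Fintype.card ι * (1 + Fintype.card J))) a₀) B₃ * B9.pref4 ((opGeo g (X × ι) (liftBlk blk ι)).len y) n *
          Real.exp (-(min (δ - σ) ρ₃ * g.dist y y')) *
            max (rateFactor (opGeo g (X × ι) (liftBlk blk ι)) γ y) (rateFactor (opGeo g (X × ι) (liftBlk blk ι)) γ y') := by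
    intro B ρ hB0 hB hρ y y'
    have hpref : 1 ≤ B9.pref4 ((opGeo g (X × ι) (liftBlk blk ι)).len y) n := by rw [opGeo_len]; exact one_le_pref4 (hlen y) n
    have hexp : Real.exp (-(ρ * g.dist y y')) ≤ Real.exp (-(min (δ - σ) ρ₃ * g.dist y y')) :=
      Real.exp_le_exp.mpr (neg_le_neg (mul_le_mul_of_nonneg_right hρ (hd y y')))
    have hrf : θ ≤ max (rateFactor (opGeo g (X × ι) (liftBlk blk ι)) γ y) (rateFactor (opGeo g (X × ι) (liftBlk blk ι)) γ y') := by
      rw [rateFactor_opGeo g (X × ι) (liftBlk blk ι) hη.ne' hL γ y']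
      exact (hθγ y').trans (le_max_right _ _)
    have hE : 0 ≤ Real.exp (-(min (δ - σ) ρ₃ * g.dist y y')) := Real.exp_nonneg _
    calc B * θ * Real.exp (-(ρ * g.dist y y'))
        ≤ (max (bgConst β cr m₀ (c35 * (Fintype.card ι * (1 + Fintype.card J))) a₀) B₃ * B9.pref4 ((opGeo g (X × ι) (liftBlk blk ι)).len y) n) * θ *
            Real.exp (-(min (δ - σ) ρ₃ * g.dist y y')) := by
          refine mul_le_mul (mul_le_mul_of_nonneg_right ?_ hθ) hexp (Real.exp_nonneg _) (mul_nonneg (mul_nonneg hB₀ (zero_le_one.trans hpref)) hθ)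
          calc B = B * 1 := (mul_one B).symm
            _ ≤ max (bgConst β cr m₀ (c35 * (Fintype.card ι * (1 + Fintype.card J))) a₀) B₃ * B9.pref4 ((opGeo g (X × ι) (liftBlk blk ι)).len y) n :=
                mul_le_mul hB hpref zero_le_one hB₀
      _ = max (bgConst β cr m₀ (c35 * (Fintype.card ι * (1 + Fintype.card J))) a₀) B₃ * B9.pref4 ((opGeo g (X × ι) (liftBlk blk ι)).len y) n *
            Real.exp (-(min (δ - σ) ρ₃ * g.dist y y')) * θ := by ring
      _ ≤ _ := mul_le_mul_of_nonneg_left hrf (mul_nonneg (mul_nonneg hB₀ (zero_le_one.trans hpref)) hE)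
  fin_cases n
  · exact (h01 none).mono (hdom hC0 (le_max_left _ _) (min_le_left _ _))
  · exact (h01 (some ν)).mono (hdom hC0 (le_max_left _ _) (min_le_left _ _))
  · exact (hT 0).mono (hdom hB₃ (le_max_right _ _) (min_le_right _ _))
  · exact (hT 1).mono (hdom hB₃ (le_max_right _ _) (min_le_right _ _))

end PerIndex

section Node

variable {I J ι : Type} [Fintype J] [DecidableEq J] [Fintype ι] [DecidableEq ι] [Nonempty ι] (g : I → B6.Geometry) (X X' : I → Type)
  [∀ i, Fintype (X i)] [∀ i, Fintype (X' i)] [∀ i, DecidableEq (X i)] [∀ i, DecidableEq (X' i)] (blk : ∀ i, X i → (g i).Site) (π : ∀ i, X' i → X i)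
  (nsh : I → ℕ) (hL0 : ∀ i, (g i).L ≠ 0) (θc θ : I → ℝ) (ν : I → J) (G : ∀ i, (X i × ι → ℝ) →ₗ[ℝ] (X i × ι → ℝ))
  (D : ∀ i, J → (X i × ι → ℝ) →ₗ[ℝ] (X i × ι → ℝ)) (G' : ∀ i, (X' i × ι → ℝ) →ₗ[ℝ] (X' i × ι → ℝ)) (D' : ∀ i, J → (X' i × ι → ℝ) →ₗ[ℝ] (X' i × ι → ℝ))
  (T : ∀ i, Fin 2 → (X' i → Matrix ι ι ℝ) × (J → X' i → Matrix ι ι ℝ) → ((X i × ι → ℝ) →ₗ[ℝ] (X' i × ι → ℝ)))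

/-- **NE2⁺, OPERATOR LAYER — `T4EtaRate.NE2PlusOperator` BY NAME FOR THE NON-ABELIAN FIRST-ORDER SPECIES, BACKGROUND BLOCK LIVE.**  For ANY family — [B6]
carriers ((2.54), `d ≥ 0`, uniform (2.61) `(σ, c_r)`, `η, L > 0`, sites of size `≥ 1`), lattices blocked and paired, `𝔤 ≅ ℝ^ι` (`ι` nonempty), a fixed direction
set `J`; the `U ≡ 1` LAYER on the product carriers with UNIFORM letters (pieces `G_i, G′_i`, derived pieces `D_{i,μ}, D′_{i,μ}` `≤ β·e^{−δd}`, `σ < δ`; defects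
`≤ m₀·θ_i·e^{−δd}`, `0 ≤ θ_i ≤ (L^j)^{−γ}`, `γ > 0`); entries 2∕3 with uniform majorants `B₃θ_i e^{−ρ₃d}` (`ρ₃ > 0`); `c₃₅ > 0` —: the realised instances over
the MATRIX coefficient carriers (guard = the datum's `M`) with the kernel families `bgFamilyM₁` (entries 0∕1 = the components of M1's CONSTRUCTED non-abelian pair)
satisfy `NE2PlusOperator c₃₅`, with `M₅ = 1`, `a₀ = (2c₃₅·|ι|(1+|J|)·(βc_r+1))⁻¹`, `B₀ = max(bgConst(…), B₃) + 1`, `δ₀ = min(δ−σ, ρ₃)`; (3.35) CONSUMED on every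
entry of every matrix coefficient. [cite: Balaban1985BackgroundPropagators, Thm 3.1 p.397 (quantifier template); (3.35) p.396, (3.50)–(3.52) p.400, (3.63)–(3.65) pp.402–403 (shapes, mechanism)] -/
theorem ne2PlusOperator_backgroundM₁ (c35 : ℝ) (hc35 : 0 < c35)
    (htri : ∀ i, Triangle254 (g i)) (hd : ∀ i (a b : (g i).Site), 0 ≤ (g i).dist a b) {σ cr : ℝ} (hσ : 0 ≤ σ) (hcr : 0 ≤ cr)
    (hrow : ∀ i, RowSum (g i) σ cr) (hη : ∀ i, 0 < (g i).eta) (hL : ∀ i, 0 < (g i).L) (hlen : ∀ i y, 1 ≤ (g i).len y)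
    {δ β m₀ γ B₃ ρ₃ : ℝ} (hσδ : σ < δ) (hβ : 0 ≤ β) (hm₀ : 0 ≤ m₀) (hγ : 0 < γ) (hθ : ∀ i, 0 ≤ θ i) (hθγ : ∀ i y, θ i ≤ rateWeight (g i) γ y)
    (hB₃ : 0 ≤ B₃) (hρ₃ : 0 < ρ₃)
    (hG : ∀ i, HasMaj (BlockNorm.ofBlocks (g i) (liftBlk (blk i) ι)) (BlockNorm.ofBlocks (g i) (liftBlk (blk i) ι)) (G i)
      (fun y y' => β * Real.exp (-(δ * (g i).dist y y'))))
    (hD : ∀ i μ, HasMaj (BlockNorm.ofBlocks (g i) (liftBlk (blk i) ι)) (BlockNorm.ofBlocks (g i) (liftBlk (blk i) ι)) (D i μ)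
      (fun y y' => β * Real.exp (-(δ * (g i).dist y y'))))
    (hG' : ∀ i, HasMaj (BlockNorm.ofBlocks (g i) (liftBlk (blk i ∘ π i) ι)) (BlockNorm.ofBlocks (g i) (liftBlk (blk i ∘ π i) ι)) (G' i)
      (fun y y' => β * Real.exp (-(δ * (g i).dist y y'))))
    (hD' : ∀ i μ, HasMaj (BlockNorm.ofBlocks (g i) (liftBlk (blk i ∘ π i) ι)) (BlockNorm.ofBlocks (g i) (liftBlk (blk i ∘ π i) ι)) (D' i μ)
      (fun y y' => β * Real.exp (-(δ * (g i).dist y y'))))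
    (hDG : ∀ i, HasMaj (BlockNorm.ofBlocks (g i) (liftBlk (blk i) ι)) (BlockNorm.ofBlocks (g i) (liftBlk (blk i ∘ π i) ι))
      (idef (pull (liftMap (π i) ι)) (pull (liftMap (π i) ι)) (G' i) (G i)) (fun y y' => m₀ * θ i * Real.exp (-(δ * (g i).dist y y'))))
    (hDD : ∀ i μ, HasMaj (BlockNorm.ofBlocks (g i) (liftBlk (blk i) ι)) (BlockNorm.ofBlocks (g i) (liftBlk (blk i ∘ π i) ι))
      (idef (pull (liftMap (π i) ι)) (pull (liftMap (π i) ι)) (D' i μ) (D i μ)) (fun y y' => m₀ * θ i * Real.exp (-(δ * (g i).dist y y'))))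
    (hT : ∀ i (U : (X' i → Matrix ι ι ℝ) × (J → X' i → Matrix ι ι ℝ)) (n : Fin 2),
      HasMaj (BlockNorm.ofBlocks (g i) (liftBlk (blk i) ι)) (BlockNorm.ofBlocks (g i) (liftBlk (blk i ∘ π i) ι)) (T i n U)
        (fun y y' => B₃ * θ i * Real.exp (-(ρ₃ * (g i).dist y y')))) :
    NE2PlusOperator c35 (fun i => bgInstanceM₁ J ι (blk i) (π i) (nsh i) (hL0 i) (θc i) (θ i))
      (fun i => bgFamilyM₁ (blk i) (π i) (nsh i) (hL0 i) (θc i) (θ i) (ν i) (G i) (D i) (G' i) (D' i) (T i)) := by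
  have hι1 : (1 : ℝ) ≤ Fintype.card ι := by exact_mod_cast Fintype.card_pos
  have hJ1 : (1 : ℝ) ≤ 1 + Fintype.card J := le_add_of_nonneg_right (Nat.cast_nonneg _)
  have hcι : (0 : ℝ) < Fintype.card ι * (1 + Fintype.card J) := mul_pos (lt_of_lt_of_le one_pos hι1) (lt_of_lt_of_le one_pos hJ1)
  set a₀ : ℝ := (2 * (c35 * (Fintype.card ι * (1 + Fintype.card J))) * (β * cr + 1))⁻¹ with ha₀_def
  have hden : 0 < 2 * (c35 * (Fintype.card ι * (1 + Fintype.card J))) * (β * cr + 1) := by positivity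
  have ha₀ : 0 < a₀ := inv_pos.2 hden
  have hq : β * (c35 * (Fintype.card ι * (1 + Fintype.card J)) * a₀) * cr ≤ 1 / 2 := by
    have h1 : β * (c35 * (Fintype.card ι * (1 + Fintype.card J)) * a₀) * cr = (β * cr) * (c35 * (Fintype.card ι * (1 + Fintype.card J)) * a₀) := by
      ring
    have h2 : c35 * (Fintype.card ι * (1 + Fintype.card J)) * a₀ = (2 * (β * cr + 1))⁻¹ := by
      rw [ha₀_def]; field_simp
    rw [h1, h2, ← div_eq_mul_inv, div_le_iff₀ (by positivity)]
    nlinarith [mul_nonneg hβ hcr]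
  have hC0 : 0 ≤ bgConst β cr m₀ (c35 * (Fintype.card ι * (1 + Fintype.card J))) a₀ :=
    bgConst_nonneg hβ hcr hm₀ (mul_nonneg hc35.le hcι.le) ha₀.le
  refine ⟨1, min (δ - σ) ρ₃, a₀, max (bgConst β cr m₀ (c35 * (Fintype.card ι * (1 + Fintype.card J))) a₀) B₃ + 1, γ, one_pos, lt_min (by linarith) hρ₃,
    ha₀, lt_of_lt_of_le one_pos (le_add_of_nonneg_left (hC0.trans (le_max_left _ _))), hγ, fun i hM α₀ hα₀ hMα U hreg => ?_⟩
  have hM' : 1 ≤ (g i).M := hM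
  have hMα' : (g i).M * α₀ ≤ a₀ := hMα
  have key := etaRateIneq342_backgroundM₁ (J := J) (ι := ι) (blk i) (π i) (htri i) (hd i) hσ hcr (hrow i) (hη i) (hL i) (hlen i) hσδ.le hβ hm₀
    (hθ i) (hθγ i) hc35 ha₀.le hq hM' hα₀ hMα' hB₃ (ν := ν i) (hG i) (hD i) (hG' i) (hD' i) (hDG i) (hDD i) hreg (hT i U)
  intro n lam y y' hs
  refine (key n lam y y' hs).trans ?_
  have hpref : 0 ≤ B9.pref4 ((bgInstanceM₁ J ι (blk i) (π i) (nsh i) (hL0 i) (θc i) (θ i)).gc.len y) n := by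
    have : 1 ≤ B9.pref4 ((opGeo (g i) (X i × ι) (liftBlk (blk i) ι)).len y) n := by rw [opGeo_len]; exact one_le_pref4 (hlen i y) n
    exact zero_le_one.trans this
  have hrf : 0 ≤ max (rateFactor (bgInstanceM₁ J ι (blk i) (π i) (nsh i) (hL0 i) (θc i) (θ i)).gc γ y)
      (rateFactor (bgInstanceM₁ J ι (blk i) (π i) (nsh i) (hL0 i) (θc i) (θ i)).gc γ y') :=
    (T4EtaRate.rateFactor_nonneg (g := opGeo (g i) (X i × ι) (liftBlk (blk i) ι)) (hη i).le (hL i).le γ y).trans (le_max_left _ _)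
  have hnorm : 0 ≤ (bgInstanceM₁ J ι (blk i) (π i) (nsh i) (hL0 i) (θc i) (θ i)).gc.supNorm lam := Real.iSup_nonneg fun x => abs_nonneg _
  have hE : 0 ≤ Real.exp (-(min (δ - σ) ρ₃ * (bgInstanceM₁ J ι (blk i) (π i) (nsh i) (hL0 i) (θc i) (θ i)).gc.dist y y')) := Real.exp_nonneg _
  exact mul_le_mul_of_nonneg_right (mul_le_mul_of_nonneg_right (mul_le_mul_of_nonneg_right
    (mul_le_mul_of_nonneg_right (le_add_of_nonneg_right zero_le_one) hpref) hE) hrf) hnorm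

end Node

end Summit.QuantumFields.YangMills.BalabanUVNodes.N15.BackgroundLayer
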